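import Summits.ResolutionOfSingularities.ResolutionOfSingularities.Theorems.MarkedTransferCampaignW46FiniteExitBoundWitness
import Literature.AlgebraicGeometry.Hironaka2017.Lib.PlanePointBlowupAmbientDatum
import HarnessLib

/-!
# [OURS · L1 W4.6 rung (i-a)′] THE LENGTH-1 PERMISSIBLE RUN OF THE CUSP OVER EVERY FIELD `K` OF CHARACTERISTIC `p` —
# the sixteen statements of `…W46FiniteExitBoundWitness.lean` (res-type-008, p503572) WITHOUT `[PerfectField K]`
# (cell res-hironaka, LADDER-RESOLUTION rung L, D-0089; campaign s46; follow-up booked by res-type-008 2026-08-27T06:17:48Z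
# and handed back by res-D-brk-2 07:01:33Z / 07:18:37Z / 07:31:55Z «your AllK len-1 witness stays yours»; host route
# MarkedTransfer, `--supports stmt-ResolutionOfSingularities-16156`; additive sibling — p503572 untouched)

HONEST FRAMING. Nothing here is a statement of H. Hironaka's manuscript (2017-03-23, [Hironaka2017]) and nothing here
asserts that any statement of it holds. Everything is OURS: kernel theorems about the campaign's typed finite permissible
sequences (`CampaignW46.FinPermissibleRun`, `regimePlaneIsolated`, `FinLocalExitBound`) at ONE explicit state. AI review
is weaker than expert review. No `sorry`; axioms standard.

## What changes w.r.t. p503572 (perfect `K`)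

The perfect-field hypothesis of p503572 entered at exactly two places: (a) «the reduced origin is regular, hence SMOOTH
over `K`» (§2.1-permissibility of the centre) and (b) «the blown-up plane is regular, hence SMOOTH over `K`» (the blown-up
plane as a row-001 `AmbientDatum`), both via `smooth_of_isRegular_of_perfectField`. Over an ARBITRARY field `K` both are
supplied by res-D-brk-2's every-field library: (a) the origin is `K`-RATIONAL, so the reduced point is `Spec K`, smooth —
`PlanePointBlowup.isPermissibleCentre_C₀` (p507777, over `Lib/RationalPointCentre` p506469); (b) ANY blowing up of `𝔸²_K`
at the origin is covered by two affine-plane charts, hence smooth over `K` — `PlanePointBlowup.ambBlowup` (p507777, over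
`Resolution/PlanePointBlowupAmbient` p505458). brk-2's `P K / f K / ξ K / C₀ K / 𝓘 K` agree with `U82Gap.Z K / f K / ξ K`,
`⟨{ξ}, _⟩`, `𝓘_{{ξ}}` DEFINITIONALLY, so the statements below are those of p503572 verbatim with `[PerfectField K]` erased;
the field-independent §1–§2 lemmas of p503572 (`sing_stage0`, `isStandard_stage0`, `cuspCurve_stage0`,
`regimePlaneIsolated_stage0`, `support_vanishingIdeal_origin_ne_top`, `vanishingIdeal_origin_ne_bot`, …) are imported, not
restated. Namespace `…CampaignW46.FinExitWitnessAllK`.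

## References

* companions `…W46FiniteExitBoundWitness` (res-type-008, p503572), `Lib/PlanePointBlowupAmbientDatum` +
  `Resolution/PlanePointBlowupAmbient` + `Lib/RationalPointCentre` (res-D-brk-2), `…W46CuspStaircasePermissibleStep`
  (res-L1-s46-pv-5), `…W46MohWindowCurveInstance` (res-L1-s46-pv-13), `…W46FiniteExitBound` (res-L1-type-o1).
* U. Görtz, T. Wedhorn, *Algebraic Geometry I* (2020), Prop. 13.92 / 13.96 — via `exists_isBlowup` / `IsBlowup.isProper`.
  [GortzWedhorn2020]
* H. Hironaka, ms. 2017-03-23, §2.1 p.4 l.34–39, Def. 2.1 p.5 l.2–3, Th. 16.13 p.87 l.26–28 — scope only, under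
  adjudication, not cited as fact. [Hironaka2017]
-/

noncomputable section

set_option linter.dupNamespace false -- mandated namespace of this single-conjunct summit

open CategoryTheory AlgebraicGeometry TopologicalSpace MvPolynomial

namespace Summit.ResolutionOfSingularities.ResolutionOfSingularities.Theorems

namespace CampaignW46

namespace FinExitWitnessAllK

open Literature.AlgebraicGeometry.Resolution
open Literature.AlgebraicGeometry.Hironaka2017.S02Preliminaries
open Literature.AlgebraicGeometry.Hironaka2017.SpecOrders
open Literature.AlgebraicGeometry.Hironaka2017.S16Proof
open Scheme.IdealSheafData
open FinExitWitness

universe u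

variable (p : ℕ) [Fact p.Prime] (K : Type u) [Field K] [CharP K p]

/-! ## §1 The centre over every field: the origin is `K`-rational -/

/-- **The origin is a §2.1-permissible centre for `E₀ = ((y^p + x^{p+1})·𝒪, p)` over EVERY field `K` of characteristic
`p`** (irreducible; the reduced point is `Spec K` — the origin is `K`-rational — hence smooth over `K`; `{ξ} ⊆ Sing(E₀)`):
res-D-brk-2's `PlanePointBlowup.isPermissibleCentre_C₀`, whose `P K`, `f K`, `C₀ K` are `U82Gap`'s plane, structure map and
reduced origin definitionally. [folklore] -/
theorem isPermissibleCentre_origin :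
    (⟨shf (MvPolynomial (Fin 2) K) (Ideal.span {X 1 ^ p + X 0 ^ (p + 1)}), p⟩ :
        IdealExponent (U82Gap.amb p K).Z).IsPermissibleCentre (U82Gap.amb p K).hom
      ⟨{U82Gap.ξ K}, U82Gap.ξ_isClosed K⟩ := by
  have hξS : PlanePointBlowup.ξ K ∈
      (⟨shf (MvPolynomial (Fin 2) K) (Ideal.span {X 1 ^ p + X 0 ^ (p + 1)}), p⟩ :
        IdealExponent (PlanePointBlowup.P K)).sing := by
    change U82Gap.ξ K ∈
      (⟨shf (MvPolynomial (Fin 2) K) (Ideal.span {X 1 ^ p + X 0 ^ (p + 1)}), p⟩ :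
        IdealExponent (U82Gap.amb p K).Z).sing
    rw [sing_stage0 p K]
    rfl
  exact PlanePointBlowup.isPermissibleCentre_C₀ K (p := p) _ hξS

/-! ## §2 The step over every field: the blown-up plane is an ambient datum -/

/-- **The permissible step exists and stays in the regime, over EVERY field `K` of characteristic `p`**: there are an
ambient datum `A₁` and a morphism `π₀ : A₁.Z ⟶ 𝔸²_K` over `K` which IS the blowing up of `𝔸²_K` along the reduced ideal
of the origin, such that the transform `E₁ = E₀.transform π₀ {ξ}` (Def. 2.1) is standard and `(A₁, E₁)` lies in
`regimePlaneIsolated` (and in the cusp staircase regime). As in p503572, except that the blown-up plane is made an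
`AmbientDatum` by res-D-brk-2's `PlanePointBlowup.ambBlowup` (smooth over `K` because covered by affine-plane charts —
no perfectness). [cite: GortzWedhorn2020, Prop. 13.92] -/
theorem exists_blowupStep :
    ∃ (A₁ : AmbientDatum p K) (π₀ : A₁.Z ⟶ (U82Gap.amb p K).Z),
      A₁.hom = π₀ ≫ (U82Gap.amb p K).hom ∧
      IsBlowup π₀ (vanishingIdeal (⟨{U82Gap.ξ K}, U82Gap.ξ_isClosed K⟩ : Closeds (U82Gap.amb p K).Z)) ∧
      ((⟨shf (MvPolynomial (Fin 2) K) (Ideal.span {X 1 ^ p + X 0 ^ (p + 1)}), p⟩ :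
          IdealExponent (U82Gap.amb p K).Z).transform π₀ ⟨{U82Gap.ξ K}, U82Gap.ξ_isClosed K⟩).IsStandard ∧
      regimePlaneIsolated A₁
        ((⟨shf (MvPolynomial (Fin 2) K) (Ideal.span {X 1 ^ p + X 0 ^ (p + 1)}), p⟩ :
          IdealExponent (U82Gap.amb p K).Z).transform π₀ ⟨{U82Gap.ξ K}, U82Gap.ξ_isClosed K⟩) ∧
      Regime.cuspCurve A₁
        ((⟨shf (MvPolynomial (Fin 2) K) (Ideal.span {X 1 ^ p + X 0 ^ (p + 1)}), p⟩ :
          IdealExponent (U82Gap.amb p K).Z).transform π₀ ⟨{U82Gap.ξ K}, U82Gap.ξ_isClosed K⟩) := by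
  -- abbreviations (local, proof-internal)
  set A₀ : AmbientDatum p K := U82Gap.amb p K with hA₀
  set E₀ : IdealExponent A₀.Z :=
    ⟨shf (MvPolynomial (Fin 2) K) (Ideal.span {X 1 ^ p + X 0 ^ (p + 1)}), p⟩ with hE₀
  set D₀ : Closeds A₀.Z := ⟨{U82Gap.ξ K}, U82Gap.ξ_isClosed K⟩ with hD₀
  haveI := A₀.smooth
  haveI := A₀.quasiCompact
  haveI : IsLocallyNoetherian A₀.Z := ambient_isLocallyNoetherian A₀
  haveI : IsIntegral A₀.Z := ambient_isIntegral A₀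
  -- the blow-up of the plane at the origin, as an ambient datum over EVERY field (res-D-brk-2)
  obtain ⟨Z₁, π₀, hπ⟩ := exists_isBlowup A₀.Z (vanishingIdeal D₀)
  have hπ' : IsBlowup π₀ (PlanePointBlowup.𝓘 K) := hπ
  let A₁ : AmbientDatum p K := PlanePointBlowup.ambBlowup p hπ'
  have hDtop : (vanishingIdeal D₀).support ≠ ⊤ := support_vanishingIdeal_origin_ne_top p K
  have hRg₀ : Regime.cuspCurve A₀ E₀ := cuspCurve_stage0 p K
  have hE₀ : E₀.IsStandard := isStandard_stage0 p K
  have hDS : (D₀ : Set A₀.Z) ⊆ E₀.sing := (isPermissibleCentre_origin p K).subset_sing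
  have hDirr : IsIrreducible (D₀ : Set A₀.Z) := isIrreducible_singleton
  -- stage 1 in the cusp staircase regime (pv-5's résumé-free one-step law)
  have hRg₁ : Regime.cuspCurve A₁ (E₀.transform π₀ D₀) :=
    Cusp.transform_cuspCurve (A' := A₁) hπ rfl hRg₀ hDirr hDS
  refine ⟨A₁, π₀, rfl, hπ, ⟨?_, hE₀.2⟩, ?_, hRg₁⟩
  · -- `J′ ⊇ J𝒪_{Z₁} ≠ 0`
    intro hbot
    apply hπ.comap_ne_bot hDtop hE₀.1
    have hle : E₀.J.comap π₀ ≤ (E₀.transform π₀ D₀).J :=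
      comap_le_controlledTransform π₀ (vanishingIdeal D₀) E₀.J E₀.b
    exact le_bot_iff.1 (hle.trans hbot.le)
  · -- `regimePlaneIsolated` at stage 1
    exact (regimePlaneIsolated_iff A₁ _).mpr
      ⟨hπ.topologicalKrullDim_le (topologicalKrullDim_plane_le_two p K), hRg₁.2.1, hRg₁.2.2.1⟩

/-! ## §3 The finite run of length 1 and the consequence for `FinLocalExitBound regimePlaneIsolated`, every field -/

/-- **[OURS · W4.6 rung (i-a)′] A NON-TRIVIAL FINITE PERMISSIBLE SEQUENCE IN THE REGIME OF RUNG (i-a), over EVERY field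
`K` of characteristic `p`**: a finite §2.1-permissible sequence `r` (`CampaignW46.FinPermissibleRun`) of length `1` all of
whose stages `0, 1` lie in `regimePlaneIsolated`, starting at the cusp state `(𝔸²_K, ((y^p + x^{p+1})·𝒪, p))`, whose one
centre `D₀ = {ξ}` is blown up by an actual blow-up and meets the fibre over the origin `ξ` (`s = {0}` satisfies the
hypothesis of the clause of `FinLocalExitBound` at `x = ξ`). p503572's statement with `[PerfectField K]` erased. NOT a
statement of the manuscript. [folklore] -/
theorem exists_finPermissibleRun_len_one :
    ∃ r : FinPermissibleRun p K,
      (⟨r.A 0, r.E 0⟩ : Σ A : AmbientDatum p K, IdealExponent A.Z) =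
          ⟨U82Gap.amb p K, ⟨shf (MvPolynomial (Fin 2) K) (Ideal.span {X 1 ^ p + X 0 ^ (p + 1)}), p⟩⟩ ∧
      r.len = 1 ∧ (∀ k, k ≤ r.len → regimePlaneIsolated (r.A k) (r.E k)) ∧
        ∃ x : (r.A 0).Z, x ∈ (r.E 0).sing ∧
          ∀ m ∈ ({0} : Finset ℕ), m < r.len ∧ ∃ y ∈ (r.D m : Set (r.A m).Z), r.down m y = x := by
  obtain ⟨A₁, π₀, hhom, hπ, hstd₁, hRg₁, -⟩ := exists_blowupStep p K
  refine
    ⟨{ len := 1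
       A := fun k => match k with
         | 0 => U82Gap.amb p K
         | _ + 1 => A₁
       E := fun k => match k with
         | 0 => ⟨shf (MvPolynomial (Fin 2) K) (Ideal.span {X 1 ^ p + X 0 ^ (p + 1)}), p⟩
         | _ + 1 =>
           (⟨shf (MvPolynomial (Fin 2) K) (Ideal.span {X 1 ^ p + X 0 ^ (p + 1)}), p⟩ :
               IdealExponent (U82Gap.amb p K).Z).transform π₀ ⟨{U82Gap.ξ K}, U82Gap.ξ_isClosed K⟩
       D := fun k => match k with
         | 0 => ⟨{U82Gap.ξ K}, U82Gap.ξ_isClosed K⟩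
         | _ + 1 => ⊥
       π := fun k => match k with
         | 0 => π₀
         | _ + 1 => 𝟙 A₁.Z
       standard := fun k hk => by
         interval_cases k
         · exact isStandard_stage0 p K
         · exact hstd₁
       permissible := fun k hk => by
         obtain rfl : k = 0 := by omega
         exact isPermissibleCentre_origin p K
       hom_eq := fun k hk => by
         obtain rfl : k = 0 := by omega
         exact hhom
       blowup := fun k hk => by
         obtain rfl : k = 0 := by omega
         exact hπ
       E_succ := fun k hk => by
         obtain rfl : k = 0 := by omega
         rfl },
      rfl, rfl, ?_, U82Gap.ξ K, ?_, ?_⟩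
  · intro k hk
    interval_cases k
    · exact regimePlaneIsolated_stage0 p K
    · exact hRg₁
  · change U82Gap.ξ K ∈
        (⟨shf (MvPolynomial (Fin 2) K) (Ideal.span {X 1 ^ p + X 0 ^ (p + 1)}), p⟩ :
          IdealExponent (U82Gap.amb p K).Z).sing
    rw [sing_stage0 p K]
    rfl
  · intro m hm
    obtain rfl : m = 0 := by simpa using hm
    exact ⟨Nat.zero_lt_one, U82Gap.ξ K, rfl, rfl⟩

/-- **[OURS · W4.6 rung (i-a)′] THE EXIT-BOUND CLAUSE IS NOT ABOUT LENGTH-0 RUNS ONLY, over EVERY field `K` of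
characteristic `p`**: every `β(A, E, x)` satisfying the clause of `CampaignW46.FinLocalExitBound regimePlaneIsolated`
satisfies `1 ≤ β(𝔸²_K, ((y^p + x^{p+1})·𝒪, p), ξ)`. p503572's statement with `[PerfectField K]` erased (the `N = 1` case
of res-D-brk-2's every-field β-price). NOT a statement of the manuscript. [folklore] -/
theorem one_le_of_finLocalExitBound_clause
    (β : ∀ A : AmbientDatum p K, IdealExponent A.Z → A.Z → ℕ)
    (hβ : ∀ r : FinPermissibleRun p K, (∀ k, k ≤ r.len → regimePlaneIsolated (r.A k) (r.E k)) →
      ∀ (x : (r.A 0).Z) (s : Finset ℕ),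
        (∀ m ∈ s, m < r.len ∧ ∃ y ∈ (r.D m : Set (r.A m).Z), r.down m y = x) → s.card ≤ β (r.A 0) (r.E 0) x) :
    1 ≤ β (U82Gap.amb p K) ⟨shf (MvPolynomial (Fin 2) K) (Ideal.span {X 1 ^ p + X 0 ^ (p + 1)}), p⟩ (U82Gap.ξ K) := by
  obtain ⟨A₁, π₀, hhom, hπ, hstd₁, hRg₁, -⟩ := exists_blowupStep p K
  let r : FinPermissibleRun p K :=
    { len := 1
      A := fun k => match k with
        | 0 => U82Gap.amb p K
        | _ + 1 => A₁
      E := fun k => match k with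
        | 0 => ⟨shf (MvPolynomial (Fin 2) K) (Ideal.span {X 1 ^ p + X 0 ^ (p + 1)}), p⟩
        | _ + 1 =>
          (⟨shf (MvPolynomial (Fin 2) K) (Ideal.span {X 1 ^ p + X 0 ^ (p + 1)}), p⟩ :
              IdealExponent (U82Gap.amb p K).Z).transform π₀ ⟨{U82Gap.ξ K}, U82Gap.ξ_isClosed K⟩
      D := fun k => match k with
        | 0 => ⟨{U82Gap.ξ K}, U82Gap.ξ_isClosed K⟩
        | _ + 1 => ⊥
      π := fun k => match k with
        | 0 => π₀
        | _ + 1 => 𝟙 A₁.Z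
      standard := fun k hk => by
        interval_cases k
        · exact isStandard_stage0 p K
        · exact hstd₁
      permissible := fun k hk => by
        obtain rfl : k = 0 := by omega
        exact isPermissibleCentre_origin p K
      hom_eq := fun k hk => by
        obtain rfl : k = 0 := by omega
        exact hhom
      blowup := fun k hk => by
        obtain rfl : k = 0 := by omega
        exact hπ
      E_succ := fun k hk => by
        obtain rfl : k = 0 := by omega
        rfl }
  have hreg : ∀ k, k ≤ r.len → regimePlaneIsolated (r.A k) (r.E k) := by
    intro k hk
    change k ≤ 1 at hk
    interval_cases k
    · exact regimePlaneIsolated_stage0 p K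
    · exact hRg₁
  have key := hβ r hreg (U82Gap.ξ K) {0} fun m hm => by
    obtain rfl : m = 0 := by simpa using hm
    exact ⟨Nat.zero_lt_one, U82Gap.ξ K, rfl, rfl⟩
  simpa using key

/-- **[OURS · W4.6 rung (i-a)′] Corollary over EVERY field: no `β` vanishing at the cusp state satisfies the clause** — in
particular `β ≡ 0` does not witness `FinLocalExitBound regimePlaneIsolated`. NOT a statement of the manuscript. [folklore] -/
theorem not_finLocalExitBound_clause_of_zero_at_cusp
    (β : ∀ A : AmbientDatum p K, IdealExponent A.Z → A.Z → ℕ)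
    (h0 : β (U82Gap.amb p K) ⟨shf (MvPolynomial (Fin 2) K) (Ideal.span {X 1 ^ p + X 0 ^ (p + 1)}), p⟩ (U82Gap.ξ K) = 0) :
    ¬ ∀ r : FinPermissibleRun p K, (∀ k, k ≤ r.len → regimePlaneIsolated (r.A k) (r.E k)) →
      ∀ (x : (r.A 0).Z) (s : Finset ℕ),
        (∀ m ∈ s, m < r.len ∧ ∃ y ∈ (r.D m : Set (r.A m).Z), r.down m y = x) → s.card ≤ β (r.A 0) (r.E 0) x := by
  intro hβ
  have h1 := one_le_of_finLocalExitBound_clause p K β hβ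
  omega

/-- **[OURS · W4.6 rung (i-a)′] On the decl of record, over EVERY field**: if `PlaneIsolatedFinLocalExitBound p K` holds, its
witness `β` is `≥ 1` at the cusp state. NOT a statement of the manuscript. [folklore] -/
theorem exists_one_le_of_planeIsolatedFinLocalExitBound (h : PlaneIsolatedFinLocalExitBound p K) :
    ∃ β : ∀ A : AmbientDatum p K, IdealExponent A.Z → A.Z → ℕ,
      (∀ r : FinPermissibleRun p K, (∀ k, k ≤ r.len → regimePlaneIsolated (r.A k) (r.E k)) →
        ∀ (x : (r.A 0).Z) (s : Finset ℕ),
          (∀ m ∈ s, m < r.len ∧ ∃ y ∈ (r.D m : Set (r.A m).Z), r.down m y = x) → s.card ≤ β (r.A 0) (r.E 0) x) ∧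
      1 ≤ β (U82Gap.amb p K) ⟨shf (MvPolynomial (Fin 2) K) (Ideal.span {X 1 ^ p + X 0 ^ (p + 1)}), p⟩ (U82Gap.ξ K) := by
  obtain ⟨β, hβ⟩ := h
  exact ⟨β, hβ, one_le_of_finLocalExitBound_clause p K β hβ⟩

end FinExitWitnessAllK

end CampaignW46

end Summit.ResolutionOfSingularities.ResolutionOfSingularities.Theorems

end
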